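import Summits.QuantumFields.YangMills.Theorems.BalabanUVNodesN06L3131HLegAtPinsPhysPU
import Summits.QuantumFields.YangMills.Theorems.BalabanUVNodesN06WELegAtPinsPhysPUB
import Literature.MathematicalPhysics.QuantumFieldTheory.Balaban1983to89.B9SmoothHolderClassStateProducers
import Literature.MathematicalPhysics.QuantumFieldTheory.Balaban1983to89.B9SmoothHolderClassStateDominated
import Literature.MathematicalPhysics.QuantumFieldTheory.Balaban1983to89.B9Thm312WholeStepDirRegular
import Literature.MathematicalPhysics.QuantumFieldTheory.Balaban1983to89.B9Thm313WholeDelta2LettersAtStatePrint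
import Literature.MathematicalPhysics.QuantumFieldTheory.Balaban1983to89.B9Thm312WholeStepRegular
import Literature.MathematicalPhysics.QuantumFieldTheory.Balaban1983to89.B9MultiscaleSmoothPartitionYNear

/-!
# N06 [B9] — THE REGULAR STATE CLASSES 𝔖₂ = (Lʲη)⁻¹·(P1′) AND 𝔖₁ = (P1′) AT THE PINS: PRODUCER `G₀D_U`, SUP READINGS, κ, ℓ¹-DOMINATION (R-generic, U-variant)

T. Bałaban, *Propagators for lattice gauge theories in a background field*, Commun. Math. Phys. **99** (1985) 389–434
[`Balaban1985BackgroundPropagators`, "B9"], (3.130) p. 421, (3.138) p. 423, (3.42)–(3.44) pp. 397–398, p. 398 (remark after (3.47)), p. 422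
(*"convergence … in all norms appearing on the left-hand sides of (3.42)–(3.47)"*); [4] = T. Bałaban, *Propagators and renormalization
transformations for lattice gauge theories. II*, Commun. Math. Phys. **96** (1984) 223–250 [`Balaban1984PropagatorsII`], (2.51)–(2.54) pp. 232–233,
Lemma 2.1 (2.60)–(2.61), (2.66) p. 234.

U8 STEP 2a (director №272 (5), dag-n06-l KNIT v2): the leaf-independent members of the state hypotheses `hstate2 ∕ hstate1` of dag-n06-l's
S-leaf `thm312Printed_completePairMBZS(_rates)` at the certificate's pins — 𝔖₂(x,U) := `weightNorm (bXH x U) (rwt (geo9Y x) (−1)) _`, 𝔖₁(x,U) := `bXH x U`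
(the (P1′) class `bHZKPG (U(Γ)) wX`):
* the producer `G₀D_U : 𝔠_W⁽¹⁾ → 𝔖₂` from the displayed sup word `hZ8.1` and the displayed probe family `hpXDv` (`(𝔭A x).ΦX U s = probeK (U(Γ)) …`
  by `rfl` at the pin `h𝔭A`) through g26's `hasMaj_into_state_of_sup_probes` — the `hGD` input of `stepS_of_lettersS`;
* the sup readings `id : 𝔖₂ → 𝔠⁽⁻²⁾` (`hasMaj_id_state`) and `id : 𝔖₁ → 𝔠⁽⁻¹⁾` (`readS_up`);
* `κ(𝔖₂) = κ(𝔖₁) ≤ 1 + C_Lip` (`weightNorm_κ`, `hκX_of_pinsP`);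
* the ℓ¹-dominations of 𝔖₂ (`exists_state_loc_le_sum`) and of 𝔖₁ (from it, finite carrier).
ONE new numeric binder family beyond the certificate of record: `hwBx13 : ∀ s ∈ (0,1), wX s·Bx13 s ≤ Bx13₀` (the class-weight budget of the displayed
`hpXDv` family, the shape of the record's `hwBG`).

HONEST LABEL: helper toward the U8 re-leaf; every member enters as a HYPOTHESIS of printed species or is derived from the certificate's displayed
members and the (P1′) pin axioms; count-neutral; N06 NOT discharged; K1⁹ NOT closed; nothing continuum ∕ OS ∕ mass gap ∕ Clay.
Cell `pub-ymgap` (HUMAN RULING D-0062), Track A node N06 [B9], seat `pub-ymgap-dag-n06-d` (g17), 2026-08-29.  NEW file; nothing landed is modified.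
-/

noncomputable section

namespace Summit.QuantumFields.YangMills.BalabanUVNodes.N06StateClassFactsAtPinsPU

open Literature.MathematicalPhysics.QuantumFieldTheory.Balaban1983to89
open Literature.MathematicalPhysics.QuantumFieldTheory.Balaban1983to89.Node00 (FBondY IBondY SiteY CfgY SiteParY SiteOpY parSymY GpY GpPhysY BondOpY toKT)
open Literature.MathematicalPhysics.QuantumFieldTheory.Balaban1983to89.Node00.OpsYSectDCoords (DvcoKH DvscoKH TpicoK T2coK cR39_trBasis_pos)
open B9Thm39ReadingCoords (cR39)
open B9Thm34Ext (toB6)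
open B11SectG (HasMaj BlockNorm RowSum)
open B9Thm312Whole (cNorm GeoOK)
open B9Thm312WholeClasses (cNormR rwt rwt_nonneg)
open B9RWSums343to347Whole (Facts347)
open B9CoReadingCoords (XBK blkBK)
open B9CoReadingCoordsS (XSK sIK blkSK GcoS)
open B9CoReadingCoordsH (XHK)
open B9CoReadingCoordsTranspose (TrIdx trBasis)
open B9PinMembersKLevelV1 (MemberY geo9Y)
open B9BackgroundsKLevelV1R (RegFamY bg9YR MemOfFam)
open B9GeoLemma21KLevelV1 (geo9Y_len_pos geo9Y_dist_triangle geo9Y_dist_comm rowSum261_geo9Y)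
open B9GeoNormsKLevelV1 (geo9K geo9K_dist_nonneg)
open B7Prop2SpecialUnitary (specialUnitaryUnits)
open B9PerturbationMajorantAlgebra (Proj349Maj Thm31GpMaj hasMaj_weaken)
open B9PerturbationMajorantsAtLetters (PcoK)
open B9MultiscaleSmoothPartitionYNear (rNear dist_sIK_le_of_nearY)
open B9SmoothHolderClassP (bHZKP bHZKPG bHZPG)
open B9GradViaDivLettersTransported (taxiB taxiS)
open B9PerturbationSplitAtLetters (TaLcoK TbLcoKH Ta2LcoK Tb2LcoKH tpi_t2_splitL_of_pins)
open B9PerturbationL2Delta2 (D2coK)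
open B9SmoothHolderClassPProducers (CTel CTel_nonneg CTel_mono CTel_mul)
open B9SmoothHolderClassTClosure (abs_cf_eq_nKT)
open B9RWSums347DefiniteFaces (geo9Y_scalars exp261 facts347_exp261_geo9Y)
open B9RowSum261DefiniteFaces (rowConst261 rowConst261_nonneg rowConst261_spec_of_rowSum261)
open B9SectDSup (weightNorm)
open B6RandomWalk (HasMajorant)
open B9Thm312WholeStepRegular (LettersS3131)
open B9Thm313WholeDelta2LettersAtStatePrint (ta2S_pins_print_of_h44G tb₂HS_pins_print_of_h43 hasMaj_state_of_raw_two)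
open Summit.QuantumFields.YangMills.BalabanUVNodes.N06HolderPinsGradedAtRecord (links_le_one)
open B6Prop22KLevelTorusCensusEta (nKT)
open B6GlobalChartV1 (PV blkV1) open B6Ineq2142KLevelV1 (β lvl) open B6Geom246MultiLevelTorus (geomT)
open scoped Matrix.Norms.L2Operator

open B9SmoothHolderClassState (hasMaj_id_state)
open B9SmoothHolderClassStateProducers (hasMaj_into_state_of_sup_probes)
open B9SmoothHolderClassStateDominated (exists_state_loc_le_sum)
open B9Thm312WholeStepDirRegular (readS_up)
open B9SectDSup (weightNorm_κ weightNorm_loc)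
open B9CoReadingCoordsHolder (PK blkPK probeK wK w₀K)
open B9CoReadingCoordsHolderAdm (wKA holderProbesKA)
open B9RWSums343Holder (HolderProbes)
open B9MultiscaleSmoothPartitionYLip (CLip)
open Summit.QuantumFields.YangMills.BalabanUVNodes.N06WELegAtPinsPhysPUB (hκX_of_pinsP)
open Literature.MathematicalPhysics.QuantumFieldTheory.Balaban1983to89.Node00 (parBY BondParY)

variable {N : ℕ} {d ℓ : ℕ} {hd : 1 ≤ d + 1} {hL : Odd (ℓ + 1) ∧ 1 < ℓ + 1} {b₀ b₁ : ℝ} {Mstar : ℕ}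

/-- ★★★ **THE STATE CLASSES AT THE PINS: PRODUCER `G₀D_U : 𝔠_W⁽¹⁾ → 𝔖₂`, SUP READINGS, κ, ℓ¹-DOMINATION** (module docstring), member-uniformly in `x`, for
`M ≥ M_T`, `Mα₀ ≤ a₀`, U ∈ (3.35)–(3.36), at the common rate `δ_S` (`δ_S + 2τ ≤ δ₁₂₃`) and closed constants `A_D`, `C_R` (`hAD hCR`).
[cite: Balaban1985BackgroundPropagators, (3.130) p.421, (3.138) p.423, (3.42)–(3.44) pp.397–398, p.398 (remark after (3.47)), p.422;
Balaban1984PropagatorsII, (2.51)–(2.54) pp.232–233, Lemma 2.1 (2.60)–(2.61), (2.66) p.234] -/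
theorem hStateFacts_of_pinsP_geo9Y [NeZero N] [∀ x : MemberY d ℓ hd hL b₀ b₁ Mstar, Fintype (geo9Y x).Site]
    {R₁ R₂ : RegFamY d ℓ hd hL b₀ b₁ Mstar (Matrix (Fin N) (Fin N) ℂ)} (H : MemberY d ℓ hd hL b₀ b₁ Mstar → Prop)
    (bI : ∀ x : MemberY d ℓ hd hL b₀ b₁ Mstar, FBondY x.toKIdx → IBondY x.toKIdx)
    (hlev : ∀ (x : MemberY d ℓ hd hL b₀ b₁ Mstar) (f : FBondY x.toKIdx), lvl x.hN x.D x.hk (bI x f) = (blkV1 x.hN x.D f).1.1)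
    (hβ1 : ∀ (x : MemberY d ℓ hd hL b₀ b₁ Mstar) (f : FBondY x.toKIdx), (geomT x.D).dist (β x.hN x.D x.hk (bI x f)) (blkV1 x.hN x.D f) ≤ 1)
    (hbI0 : ∀ (x : MemberY d ℓ hd hL b₀ b₁ Mstar) (f : FBondY x.toKIdx), bI x f = bI x ⟨f.src, 0⟩)
    (c : ℝ) {M₀ a₀ : ℝ} {τ : ℝ} (hτ : 0 < τ)
    (wX : ℝ → ℝ) (hwX₀ : ∀ s, 0 ≤ wX s) (hwX₁ : ∀ s, wX s ≤ 1)
    (bXH : ∀ x : MemberY d ℓ hd hL b₀ b₁ Mstar, (bg9YR (Matrix (Fin N) (Fin N) ℂ) (specialUnitaryUnits (Fin N)) R₁ R₂ x).Cfg → BlockNorm (toB6 (geo9Y x) 1 (H x)) (XBK (TrIdx N) x.toKIdx → ℝ))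
    (hbXH : ∀ (x : MemberY d ℓ hd hL b₀ b₁ Mstar) (U : (bg9YR (Matrix (Fin N) (Fin N) ℂ) (specialUnitaryUnits (Fin N)) R₁ R₂ x).Cfg), bXH x U =
      letI : Fintype (geo9K x.toKIdx).Site := (inferInstance : Fintype (geo9Y x).Site);
      bHZKPG (κ := TrIdx N) x.toKIdx (trBasis N) (taxiB x.toKIdx (bg9YR (Matrix (Fin N) (Fin N) ℂ) (specialUnitaryUnits (Fin N)) R₁ R₂ x) (fun U => U) U) (R := (1 : ℝ)) (H := H x) wX hwX₀ hwX₁)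
    {s44 : ℝ} (hs440 : 0 < s44) (hs441 : s44 < 1) (hwX44 : 0 < wX s44)
    (𝔬12 : ∀ x : MemberY d ℓ hd hL b₀ b₁ Mstar, B9Thm312Whole.Ops (geo9Y x) (bg9YR (Matrix (Fin N) (Fin N) ℂ) (specialUnitaryUnits (Fin N)) R₁ R₂ x) (XBK (TrIdx N) x.toKIdx) (XBK (TrIdx N) x.toKIdx) (XHK (TrIdx N) x.toKIdx) (XSK (TrIdx N) x.toKIdx))
    (hblk12 : ∀ x : MemberY d ℓ hd hL b₀ b₁ Mstar, (𝔬12 x).blk = blkBK x.toKIdx (bI x))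
    (hblkW12 : ∀ x : MemberY d ℓ hd hL b₀ b₁ Mstar, (𝔬12 x).blkW = blkSK x.toKIdx (sIK x.toKIdx (bI x)))
    (𝔭A : ∀ x : MemberY d ℓ hd hL b₀ b₁ Mstar, HolderProbes (geo9Y x) (bg9YR (Matrix (Fin N) (Fin N) ℂ) (specialUnitaryUnits (Fin N)) R₁ R₂ x) (XBK (TrIdx N) x.toKIdx) (XBK (TrIdx N) x.toKIdx) (PK (FBondY x.toKIdx) (Fin (d + 1)) (TrIdx N)) (PK (FBondY x.toKIdx) (Fin (d + 1)) (TrIdx N)))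
    {parB : ∀ x : MemberY d ℓ hd hL b₀ b₁ Mstar, BondParY (Matrix (Fin N) (Fin N) ℂ) x.toKIdx} (hparB : ∀ x : MemberY d ℓ hd hL b₀ b₁ Mstar, parB x = parBY x.toKIdx)
    (h𝔭A : ∀ x : MemberY d ℓ hd hL b₀ b₁ Mstar, 𝔭A x = holderProbesKA x.toKIdx (trBasis N) (bg9YR (Matrix (Fin N) (Fin N) ℂ) (specialUnitaryUnits (Fin N)) R₁ R₂ x) (fun U => U) (parB x) (bI x))
    {B12₃ δ12₃ Bx13₀ δS AD CR : ℝ} {Bx13 : ℝ → ℝ} (hB12₃ : 0 ≤ B12₃) (hBx13 : ∀ β, 0 ≤ β → β < 1 → 0 ≤ Bx13 β) (hBx13₀ : 0 ≤ Bx13₀)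
    (hwBx13 : ∀ s, 0 < s → s < 1 → wX s * Bx13 s ≤ Bx13₀) (hδS : 0 ≤ δS) (hδS₃ : δS + 2 * τ ≤ δ12₃)
    (hAD : (((ℓ + 1 : ℕ) : ℝ)) * (B12₃ * (((ℓ + 1 : ℕ) : ℝ)) + Bx13₀) * Real.exp ((δS + τ) * (rNear d ℓ + 1)) * (((ℓ + 1 : ℕ) : ℝ)) ≤ AD)
    (hCR : (wX s44)⁻¹ * ((((ℓ + 1 : ℕ) : ℝ)) * Real.exp ((δS + 2 * τ) * (rNear d ℓ + 1))) * (((ℓ + 1 : ℕ) : ℝ)) * (((ℓ + 1 : ℕ) : ℝ)) ≤ CR)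
    (hZ81 : ∀ x : MemberY d ℓ hd hL b₀ b₁ Mstar, M₀ ≤ (geo9Y x).M → ∀ α₀ : ℝ, 0 < α₀ → (geo9Y x).M * α₀ ≤ a₀ → ∀ U : (bg9YR (Matrix (Fin N) (Fin N) ℂ) (specialUnitaryUnits (Fin N)) R₁ R₂ x).Cfg, (bg9YR (Matrix (Fin N) (Fin N) ℂ) (specialUnitaryUnits (Fin N)) R₁ R₂ x).Reg335 c α₀ U → (bg9YR (Matrix (Fin N) (Fin N) ℂ) (specialUnitaryUnits (Fin N)) R₁ R₂ x).Reg336 c α₀ U →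
      HasMaj (cNorm 1 (H x) (𝔬12 x).blkW (fun y => (geo9Y_len_pos x y).le) 1) (cNorm 1 (H x) (𝔬12 x).blk (fun y => (geo9Y_len_pos x y).le) 2) ((𝔬12 x).G0 U ∘ₗ (𝔬12 x).Dv U)
        (fun a b => B12₃ * Real.exp (-(δ12₃ * (geo9Y x).dist a b))))
    (hpXDv : ∀ x : MemberY d ℓ hd hL b₀ b₁ Mstar, M₀ ≤ (geo9Y x).M → ∀ α₀ : ℝ, 0 < α₀ → (geo9Y x).M * α₀ ≤ a₀ → ∀ U : (bg9YR (Matrix (Fin N) (Fin N) ℂ) (specialUnitaryUnits (Fin N)) R₁ R₂ x).Cfg, (bg9YR (Matrix (Fin N) (Fin N) ℂ) (specialUnitaryUnits (Fin N)) R₁ R₂ x).Reg335 c α₀ U → (bg9YR (Matrix (Fin N) (Fin N) ℂ) (specialUnitaryUnits (Fin N)) R₁ R₂ x).Reg336 c α₀ U → ∀ β : ℝ, 0 ≤ β → β < 1 →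
      HasMaj (cNormR 1 (H x) (𝔬12 x).blkW (fun y => (geo9Y_len_pos x y).le) 0) (cNormR 1 (H x) (𝔭A x).blkPX (fun y => (geo9Y_len_pos x y).le) (β - 1))
        (((𝔭A x).ΦX U β ∘ₗ (𝔬12 x).G0 U) ∘ₗ (𝔬12 x).Dv U) (fun a b => Bx13 β * Real.exp (-(δ12₃ * (geo9Y x).dist a b)))) :
    ∃ MT : ℝ, ∀ x : MemberY d ℓ hd hL b₀ b₁ Mstar, MT ≤ (geo9Y x).M → ∀ α₀ : ℝ, 0 < α₀ → (geo9Y x).M * α₀ ≤ a₀ → ∀ U : (bg9YR (Matrix (Fin N) (Fin N) ℂ) (specialUnitaryUnits (Fin N)) R₁ R₂ x).Cfg, (bg9YR (Matrix (Fin N) (Fin N) ℂ) (specialUnitaryUnits (Fin N)) R₁ R₂ x).Reg335 c α₀ U → (bg9YR (Matrix (Fin N) (Fin N) ℂ) (specialUnitaryUnits (Fin N)) R₁ R₂ x).Reg336 c α₀ U →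
      HasMaj (cNorm 1 (H x) (𝔬12 x).blkW (fun y => (geo9Y_len_pos x y).le) 1) (weightNorm (bXH x U) (rwt (geo9Y x) (-1)) (rwt_nonneg (fun y => (geo9Y_len_pos x y).le) (-1))) ((𝔬12 x).G0 U ∘ₗ (𝔬12 x).Dv U)
          (fun a b => AD * Real.exp (-(δS * (geo9Y x).dist a b))) ∧
        HasMaj (weightNorm (bXH x U) (rwt (geo9Y x) (-1)) (rwt_nonneg (fun y => (geo9Y_len_pos x y).le) (-1))) (cNormR 1 (H x) (𝔬12 x).blk (fun y => (geo9Y_len_pos x y).le) (-2)) LinearMap.id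
          (fun a b => CR * Real.exp (-(δS * (geo9Y x).dist a b))) ∧
        HasMaj (bXH x U) (cNormR 1 (H x) (𝔬12 x).blk (fun y => (geo9Y_len_pos x y).le) (-1)) LinearMap.id
          (fun a b => CR * Real.exp (-(δS * (geo9Y x).dist a b))) ∧
        (weightNorm (bXH x U) (rwt (geo9Y x) (-1)) (rwt_nonneg (fun y => (geo9Y_len_pos x y).le) (-1))).κ ≤ 1 + CLip d ℓ ∧ (bXH x U).κ ≤ 1 + CLip d ℓ ∧
        (∃ Λ : ℝ, 0 ≤ Λ ∧ ∀ (y : (geo9Y x).Site) (F : XBK (TrIdx N) x.toKIdx → ℝ), (weightNorm (bXH x U) (rwt (geo9Y x) (-1)) (rwt_nonneg (fun y => (geo9Y_len_pos x y).le) (-1))).loc y F ≤ Λ * ∑ q : XBK (TrIdx N) x.toKIdx, |F q|) ∧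
        (∃ Λ : ℝ, 0 ≤ Λ ∧ ∀ (y : (geo9Y x).Site) (F : XBK (TrIdx N) x.toKIdx → ℝ), (bXH x U).loc y F ≤ Λ * ∑ q : XBK (TrIdx N) x.toKIdx, |F q|) := by
  obtain ⟨Mg, hFa⟩ := facts347_exp261_geo9Y (d := d) (ℓ := ℓ) (hd := hd) (hL := hL) (b₀ := b₀) (b₁ := b₁) (Mstar := Mstar) H (α := 1 / 2) (δ := 2 * τ)
    (by norm_num) (by norm_num) (by linarith)
  have hτ' : (0 : ℝ) ≤ 1 / 2 * (2 * τ) := by linarith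
  have hτe : (1 : ℝ) / 2 * (2 * τ) = τ := by ring
  refine ⟨max M₀ Mg, fun x hM α₀ hα ha U hU hU' => ?_⟩
  letI : Fintype (geo9K x.toKIdx).Site := (inferInstance : Fintype (geo9Y x).Site)
  have hM0 : M₀ ≤ (geo9Y x).M := (le_max_left _ _).trans hM
  have hFax := hFa x ((le_max_right _ _).trans hM)
  have hG : GeoOK (geo9Y x) := ⟨geo9Y_dist_triangle x, geo9Y_dist_comm x, geo9K_dist_nonneg x.toKIdx, geo9Y_len_pos x⟩
  have hcf := abs_cf_eq_nKT x.toKIdx x.hcfk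
  have hNr : ∀ (y : IBondY x.toKIdx) (z : SiteY x.toKIdx), B9MultiscaleSmoothPartitionY.NearY x.toKIdx y z → (geo9K x.toKIdx).dist y (sIK x.toKIdx (bI x) z) ≤ rNear d ℓ + 1 :=
    fun y z h => dist_sIK_le_of_nearY x.toKIdx (hβ1 x) h
  have hLxK : (geo9K x.toKIdx).L ≤ (((ℓ + 1 : ℕ) : ℝ)) := (geo9Y_scalars x).2.1
  have hLx : (geo9Y x).L ≤ (((ℓ + 1 : ℕ) : ℝ)) := (geo9Y_scalars x).2.1
  have hL0K : 0 ≤ (geo9K x.toKIdx).L := le_trans zero_le_one hFax.one_le_L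
  have hL1K : 1 ≤ (geo9K x.toKIdx).L := hFax.one_le_L
  have hws' : 0 ≤ (wX s44)⁻¹ := inv_nonneg.2 hwX44.le
  -- (1) the producer G₀D_U : 𝔠_W⁽¹⁾ → 𝔖₂ (g26 `hasMaj_into_state_of_sup_probes` from hZ8.1 + the hpXDv family along U(Γ))
  have hsup := hZ81 x hM0 α₀ hα ha U hU hU'
  rw [hblk12 x, hblkW12 x] at hsup
  have hpr : ∀ s : ℝ, 0 < s → s < 1 →
      HasMaj (cNormR 1 (H x) (blkSK x.toKIdx (sIK x.toKIdx (bI x))) hG.lenle 0) (cNormR 1 (H x) (blkPK (bI x)) hG.lenle (s - 1))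
        (probeK (trBasis N) (taxiB x.toKIdx (bg9YR (Matrix (Fin N) (Fin N) ℂ) (specialUnitaryUnits (Fin N)) R₁ R₂ x) (fun U => U) U) (wKA x.toKIdx s) (w₀K x.toKIdx s) ∘ₗ ((𝔬12 x).G0 U ∘ₗ (𝔬12 x).Dv U))
        (fun a a' => Bx13 s * Real.exp (-((δS + τ) * (geo9K x.toKIdx).dist a a'))) := by
    intro s hs0 hs1
    have h := hpXDv x hM0 α₀ hα ha U hU hU' s hs0.le hs1
    rw [hblkW12 x, h𝔭A x, hparB x] at h
    exact hasMaj_weaken hG (hBx13 s hs0.le hs1) le_rfl (by linarith) h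
  have hGD := hasMaj_into_state_of_sup_probes x.toKIdx (trBasis N) (taxiB x.toKIdx (bg9YR (Matrix (Fin N) (Fin N) ℂ) (specialUnitaryUnits (Fin N)) R₁ R₂ x) (fun U => U) U) (R := (1 : ℝ)) (H := H x) wX hwX₀ hwX₁ hG hFax
    (hβ1 x) (hlev x) (hbI0 x) hcf (T := (𝔬12 x).G0 U ∘ₗ (𝔬12 x).Dv U) hB12₃ hBx13₀ (fun s hs0 hs1 => hBx13 s hs0.le hs1) hwBx13 (δ := δS + τ) (by linarith)
    (show δS + τ + 1 / 2 * (2 * τ) ≤ δ12₃ by linarith) hsup hpr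
  rw [hτe, show δS + τ - τ = δS by ring, ← hblkW12 x] at hGD
  -- (2) the sup readings of 𝔖₂ and 𝔖₁
  have hR2 := hasMaj_id_state x.toKIdx (trBasis N) (taxiB x.toKIdx (bg9YR (Matrix (Fin N) (Fin N) ℂ) (specialUnitaryUnits (Fin N)) R₁ R₂ x) (fun U => U) U) (R := (1 : ℝ)) (H := H x) wX hwX₀ hwX₁ hG hFax hs440 hs441 hwX44
    (hlev x) (hbI0 x) (δ := δS + 2 * τ) (by linarith) hNr hcf
  rw [hτe, show δS + 2 * τ - τ = δS + τ by ring, ← hblk12 x] at hR2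
  have hCs : 0 ≤ (wX s44)⁻¹ * ((((ℓ + 1 : ℕ) : ℝ)) * Real.exp ((δS + 2 * τ) * (rNear d ℓ + 1))) * (geo9K x.toKIdx).L := by positivity
  have hR1 := readS_up hG hFax hCs hR2
  rw [hτe, show δS + τ - τ = δS by ring] at hR1
  -- (3) ℓ¹-dominations
  obtain ⟨Λ, hΛ0, hΛ⟩ := exists_state_loc_le_sum x.toKIdx (trBasis N) (taxiB x.toKIdx (bg9YR (Matrix (Fin N) (Fin N) ℂ) (specialUnitaryUnits (Fin N)) R₁ R₂ x) (fun U => U) U) (R₀ := (1 : ℝ)) (H₀ := H x) wX hwX₀ hwX₁ hG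
  obtain ⟨Lm, hLm⟩ := Finite.exists_le (fun y : (geo9K x.toKIdx).Site => (geo9K x.toKIdx).len y)
  have hκ := hκX_of_pinsP H wX hwX₀ hwX₁ bXH hbXH x U
  rw [hbXH x U]
  refine ⟨hGD.mono fun a b => mul_le_mul_of_nonneg_right ?_ (Real.exp_nonneg _), ?_, ?_, ?_, ?_, ⟨Λ, hΛ0, hΛ⟩, ?_⟩
  · calc _ ≤ (((ℓ + 1 : ℕ) : ℝ)) * (B12₃ * (((ℓ + 1 : ℕ) : ℝ)) + Bx13₀) * Real.exp ((δS + τ) * (rNear d ℓ + 1)) * (((ℓ + 1 : ℕ) : ℝ)) := by gcongr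
      _ ≤ AD := hAD
  · refine hasMaj_weaken hG (by positivity) ?_ (show δS ≤ δS + τ by linarith) hR2
    calc _ ≤ (wX s44)⁻¹ * ((((ℓ + 1 : ℕ) : ℝ)) * Real.exp ((δS + 2 * τ) * (rNear d ℓ + 1))) * (((ℓ + 1 : ℕ) : ℝ)) * (((ℓ + 1 : ℕ) : ℝ)) := by
          have h1 : (wX s44)⁻¹ * ((((ℓ + 1 : ℕ) : ℝ)) * Real.exp ((δS + 2 * τ) * (rNear d ℓ + 1))) * (geo9K x.toKIdx).L ≤
              (wX s44)⁻¹ * ((((ℓ + 1 : ℕ) : ℝ)) * Real.exp ((δS + 2 * τ) * (rNear d ℓ + 1))) * (((ℓ + 1 : ℕ) : ℝ)) := by gcongr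
          have h2 : 0 ≤ (wX s44)⁻¹ * ((((ℓ + 1 : ℕ) : ℝ)) * Real.exp ((δS + 2 * τ) * (rNear d ℓ + 1))) * (((ℓ + 1 : ℕ) : ℝ)) := by positivity
          nlinarith [hFax.one_le_L.trans hLxK]
      _ ≤ CR := hCR
  · refine hR1.mono fun a b => mul_le_mul_of_nonneg_right ?_ (Real.exp_nonneg _)
    calc _ ≤ (wX s44)⁻¹ * ((((ℓ + 1 : ℕ) : ℝ)) * Real.exp ((δS + 2 * τ) * (rNear d ℓ + 1))) * (((ℓ + 1 : ℕ) : ℝ)) * (((ℓ + 1 : ℕ) : ℝ)) := by gcongr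
      _ ≤ CR := hCR
  · rw [weightNorm_κ, ← hbXH x U]; exact hκ
  · rw [← hbXH x U]; exact hκ
  · refine ⟨Λ * max Lm 0, by positivity, fun y F => ?_⟩
    have h1 := hΛ y F
    rw [weightNorm_loc] at h1
    have hlen : 0 < (geo9K x.toKIdx).len y := geo9Y_len_pos x y
    have hr : rwt (geo9K x.toKIdx) (-1) y = ((geo9K x.toKIdx).len y)⁻¹ := by unfold rwt; exact Real.rpow_neg_one _
    rw [hr] at h1
    have h2 : (bHZKPG (κ := TrIdx N) x.toKIdx (trBasis N) (taxiB x.toKIdx (bg9YR (Matrix (Fin N) (Fin N) ℂ) (specialUnitaryUnits (Fin N)) R₁ R₂ x) (fun U => U) U) (R := (1 : ℝ)) (H := H x) wX hwX₀ hwX₁).loc y F ≤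
        (geo9K x.toKIdx).len y * (Λ * ∑ q : XBK (TrIdx N) x.toKIdx, |F q|) := by
      rw [← inv_mul_le_iff₀ hlen]; exact h1
    have hS : 0 ≤ ∑ q : XBK (TrIdx N) x.toKIdx, |F q| := Finset.sum_nonneg fun q _ => abs_nonneg _
    calc _ ≤ (geo9K x.toKIdx).len y * (Λ * ∑ q : XBK (TrIdx N) x.toKIdx, |F q|) := h2
      _ ≤ max Lm 0 * (Λ * ∑ q : XBK (TrIdx N) x.toKIdx, |F q|) := mul_le_mul_of_nonneg_right ((hLm y).trans (le_max_left _ _)) (by positivity)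
      _ = Λ * max Lm 0 * ∑ q : XBK (TrIdx N) x.toKIdx, |F q| := by ring

end Summit.QuantumFields.YangMills.BalabanUVNodes.N06StateClassFactsAtPinsPU

end
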